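import Literature.NumberTheory.DiophantineGeometry.CafureMateraThm54Proofs
import Literature.NumberTheory.DiophantineGeometry.CafureMateraProofs
import Mathlib.LinearAlgebra.FiniteDimensional.Lemmas
import HarnessLib

/-!
# Counting the parametrised planes with a reducible section (Cafure–Matera Cor. 3.2, parametrised)

Let `K = 𝔽_q`, `f ∈ K[X₁, …, Xₙ]` absolutely irreducible of degree `δ`, and for
`(p, v, w) ∈ (Kⁿ)³` let `f(p + Xv + Yw) ∈ K[X][Y]` be the plane section
(`MvPolynomial.aeval (fun i ↦ C (C (w i)) * Y + C (C (p i) + C (v i) * X)) f`, as in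
`CafureMateraAveragingProofs`). We prove the counting form of the effective Bertini theorem behind
Cafure–Matera's Cor. 3.2 (there for the `q^{3n-2}` parametrisations of type (10), with Kaltofen's
sharper constant `3δ⁴/2 - 2δ³ + 5δ²/2`):

* `card_filter_not_irreducible_planeSection_le`: the number of `(p, v, w)` for which
  `f(p + Xv + Yw)` is **not** absolutely irreducible is at most
  `(2δ⁴ - δ³ + 2δ² + 1) q^{3n-1}` (stated as a sum of the three contributions below).

The proof re-runs the proof of Thm. 5.4 in the tree (`CafureMateraThm54Proofs`) with counts in place
of existence statements: (i) the directions `w` with `f_δ(w) = 0` or `D_w f = 0` are at most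
`(δ + 1) q^{n-1}` (Lemma 2.1, and a proper subspace has at most `q^{n-1}` points); (ii) for a good
`w`, the base points `p` with `f(p + Tw)` not coprime to its derivative are roots of the resultant
`Res_T(G, ∂G/∂T) ≠ 0` of degree `≤ (2δ-1)δ` (`BertiniSeparabilityProofs`), at most
`(2δ-1)δ q^{n-1}` of them; (iii) for good `(p, w)`, Kaltofen's certificate `Υ ∈ K̄[Z]`,
`deg Υ ≤ δ²(2δ² - δ)` (`BertiniSpecializationProofs`), vanishes at every `v ∈ Kⁿ` with
`f(p + Xv + Yw)` not absolutely irreducible: at most `δ²(2δ²-δ) q^{n-1}` such `v` (Schwartz–Zippel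
over the image of `K` in `K̄`).

No definitions, no new named facts.

## References

* A. Cafure, G. Matera, *Improved explicit estimates on the number of solutions of equations over
  a finite field*, Finite Fields Appl. 12 (2006) 155–185, §3.2, Cor. 3.2. [CafureMatera2006]
* E. Kaltofen, *Effective Noether irreducibility forms and applications*, J. Comput. System Sci.
  50 (1995) 274–295, Thm. 5. [Kaltofen1995]
-/

noncomputable section

open scoped Classical Polynomial Polynomial.Bivariate
open Polynomial

namespace Literature.NumberTheory.DiophantineGeometry

universe u v

variable {K : Type u} [Field K] {n : ℕ}

/-- The plane section `f(p + Xv + Yw) ∈ K[X][Y]` (local notation). -/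
local notation3 (prettyPrint := false) "sec[" f ", " p ", " v ", " w "]" =>
  (MvPolynomial.aeval (R := K) (fun i ↦ Polynomial.C (Polynomial.C (w i)) * Polynomial.X +
      Polynomial.C (Polynomial.C (p i) + Polynomial.C (v i) * Polynomial.X)) f)

/-! ### Schwartz–Zippel over the image of `K` in an extension -/

/-- **Schwartz–Zippel at the `K`-rational points of an extension:** a non-zero `p ∈ L[Z₁, …, Zₙ]`
of total degree `d` vanishes at at most `d q^{n-1}` points of `σ(K)ⁿ ≅ Kⁿ`.
[cite: CafureMatera2006, Lemma 2.1] -/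
theorem card_filter_eval_comp_eq_zero_le_of_ne_zero [Fintype K] {L : Type v} [Field L] (σ : K →+* L)
    {p : MvPolynomial (Fin n) L} (hp : p ≠ 0) :
    (Finset.univ.filter fun x : Fin n → K ↦ MvPolynomial.eval (σ ∘ x) p = 0).card ≤
      p.totalDegree * Fintype.card K ^ (n - 1) := by
  rcases Nat.eq_zero_or_pos n with hn | hn
  · -- `n = 0`: `p` is a non-zero constant
    subst hn
    have hc : p.coeff 0 ≠ 0 := by
      intro h0; apply hp; rw [p.eq_C_of_isEmpty, h0, MvPolynomial.C_0]
    have : (Finset.univ.filter fun x : Fin 0 → K ↦ MvPolynomial.eval (σ ∘ x) p = 0) = ∅ := by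
      refine Finset.filter_false_of_mem fun x _ ↦ ?_
      rw [p.eq_C_of_isEmpty, MvPolynomial.eval_C]
      exact hc
    rw [this, Finset.card_empty]
    exact Nat.zero_le _
  set S : Finset L := Finset.univ.image σ with hS
  have hScard : S.card = Fintype.card K := by
    rw [hS, Finset.card_image_of_injective _ σ.injective, Finset.card_univ]
  have hsz := MvPolynomial.schwartz_zippel_totalDegree hp S
  have hq0 : (0 : ℚ≥0) < S.card := by rw [hScard]; exact_mod_cast Fintype.card_pos
  -- the `σ`-image of the filter is the Schwartz–Zippel set
  have hcard : (Finset.univ.filter fun x : Fin n → K ↦ MvPolynomial.eval (σ ∘ x) p = 0).card =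
      (Finset.filter (fun x ↦ MvPolynomial.eval x p = 0) (Fintype.piFinset fun _ : Fin n ↦ S)).card := by
    refine Finset.card_bij (fun x _ ↦ σ ∘ x) (fun x hx ↦ ?_) (fun x₁ _ x₂ _ h ↦ ?_) (fun y hy ↦ ?_)
    · rw [Finset.mem_filter] at hx ⊢
      refine ⟨Fintype.mem_piFinset.2 fun i ↦ Finset.mem_image.2 ⟨x i, Finset.mem_univ _, rfl⟩, hx.2⟩
    · exact funext fun i ↦ σ.injective (congrFun h i)
    · rw [Finset.mem_filter, Fintype.mem_piFinset] at hy
      choose x hx using fun i ↦ Finset.mem_image.1 (hy.1 i)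
      refine ⟨x, ?_, funext fun i ↦ (hx i).2⟩
      rw [Finset.mem_filter]
      have : σ ∘ x = y := funext fun i ↦ (hx i).2
      exact ⟨Finset.mem_univ _, by rw [this]; exact hy.2⟩
  rw [hcard]
  set Z := (Finset.filter (fun x ↦ MvPolynomial.eval x p = 0)
    (Fintype.piFinset fun _ : Fin n ↦ S)).card with hZ
  have h1 : (Z : ℚ≥0) ≤ p.totalDegree * (S.card : ℚ≥0) ^ (n - 1) := by
    have hpow : (S.card : ℚ≥0) ^ n = (S.card : ℚ≥0) ^ (n - 1) * S.card := by
      rw [← pow_succ]; congr 1; omega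
    have hpos : (0 : ℚ≥0) < (S.card : ℚ≥0) ^ n := pow_pos hq0 n
    rw [div_le_div_iff₀ hpos hq0] at hsz
    rw [hpow] at hsz
    have : (Z : ℚ≥0) * S.card ≤ p.totalDegree * (S.card : ℚ≥0) ^ (n - 1) * S.card := by
      calc (Z : ℚ≥0) * S.card ≤ p.totalDegree * ((S.card : ℚ≥0) ^ (n - 1) * S.card) := hsz
        _ = _ := by ring
    exact le_of_mul_le_mul_right this hq0
  rw [hScard] at h1
  exact_mod_cast h1

/-! ### The bad directions -/

variable [Fintype K]

/-- **At most `q^{n-1}` directions kill the gradient:** if some `∂ᵢ f ≠ 0`, the directions `w`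
with `D_w f = ∑ wᵢ ∂ᵢ f = 0` form a proper subspace of `Kⁿ`. [folklore] -/
theorem card_filter_sum_C_mul_pderiv_eq_zero_le {f : MvPolynomial (Fin n) K} {i₀ : Fin n}
    (hi₀ : MvPolynomial.pderiv i₀ f ≠ 0) :
    (Finset.univ.filter fun w : Fin n → K ↦
        (∑ i, MvPolynomial.C (w i) * MvPolynomial.pderiv i f) = 0).card ≤
      Fintype.card K ^ (n - 1) := by
  -- the linear map `w ↦ D_w f`
  set Lmap : (Fin n → K) →ₗ[K] MvPolynomial (Fin n) K :=
    { toFun := fun w ↦ ∑ i, MvPolynomial.C (w i) * MvPolynomial.pderiv i f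
      map_add' := fun w w' ↦ by
        simp only [Pi.add_apply, map_add, add_mul, Finset.sum_add_distrib]
      map_smul' := fun c w ↦ by
        simp only [Pi.smul_apply, smul_eq_mul, map_mul, RingHom.id_apply, Finset.smul_sum,
          MvPolynomial.smul_eq_C_mul, mul_assoc] } with hLmap
  set V := LinearMap.ker Lmap with hV
  have hVtop : V ≠ ⊤ := by
    intro htop
    have hmem : (Pi.single i₀ (1 : K) : Fin n → K) ∈ V := htop ▸ Submodule.mem_top
    rw [hV, LinearMap.mem_ker] at hmem
    apply hi₀
    have : Lmap (Pi.single i₀ 1) = MvPolynomial.pderiv i₀ f := by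
      simp only [hLmap, LinearMap.coe_mk, AddHom.coe_mk]
      rw [Finset.sum_eq_single i₀]
      · simp
      · intro i _ hi; simp [Pi.single_eq_of_ne hi]
      · intro h; exact absurd (Finset.mem_univ _) h
    rw [← this]
    exact hmem
  have hfin : Module.finrank K V < n := by
    have := Submodule.finrank_lt hVtop
    rwa [Module.finrank_fin_fun] at this
  have hcardV : Fintype.card V = Fintype.card K ^ Module.finrank K V := Module.card_eq_pow_finrank
  have heq : (Finset.univ.filter fun w : Fin n → K ↦
      (∑ i, MvPolynomial.C (w i) * MvPolynomial.pderiv i f) = 0).card = Fintype.card V := by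
    rw [Fintype.card_subtype]
    refine congrArg Finset.card (Finset.filter_congr fun w _ ↦ ?_)
    rw [hV, LinearMap.mem_ker]
    rfl
  rw [heq, hcardV]
  exact Nat.pow_le_pow_right Fintype.card_pos (by omega)

/-- **The bad directions are few:** the `w` with `f_δ(w) = 0` or `D_w f = 0` number at most
`(δ + 1) q^{n-1}` (`f ≠ 0` of degree `δ`, some `∂ᵢ f ≠ 0`). [cite: CafureMatera2006, §3.2] -/
theorem card_filter_badDirection_le {f : MvPolynomial (Fin n) K} (hf : f ≠ 0) {i₀ : Fin n}
    (hi₀ : MvPolynomial.pderiv i₀ f ≠ 0) :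
    (Finset.univ.filter fun w : Fin n → K ↦
        MvPolynomial.eval w (MvPolynomial.homogeneousComponent f.totalDegree f) = 0 ∨
          (∑ i, MvPolynomial.C (w i) * MvPolynomial.pderiv i f) = 0).card ≤
      (f.totalDegree + 1) * Fintype.card K ^ (n - 1) := by
  set fδ := MvPolynomial.homogeneousComponent f.totalDegree f with hfδ
  have hfδ0 : fδ ≠ 0 := homogeneousComponent_totalDegree_ne_zero hf
  have hfδdeg : fδ.totalDegree = f.totalDegree :=
    (MvPolynomial.homogeneousComponent_isHomogeneous f.totalDegree f).totalDegree hfδ0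
  rw [Finset.filter_or, add_mul, one_mul]
  refine (Finset.card_union_le _ _).trans (Nat.add_le_add ?_ ?_)
  · have := rationalPointCount_le_totalDegree_mul hfδ0
    rwa [hfδdeg] at this
  · exact card_filter_sum_C_mul_pderiv_eq_zero_le hi₀

/-! ### The bad base points for a good direction -/

omit [Fintype K] in
/-- **Separability of `f(p + Tw)` off the resultant hypersurface:** if `Res_T(G, ∂G/∂T)(p) ≠ 0`
for `G = f(Z + Tw)`, then `g_p = f(p + Tw)` is coprime to its derivative (the Bézout identity for
the resultant specialises). [cite: CafureMatera2006, §3.2] -/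
theorem isCoprime_lineSpecialization_of_eval_ne_zero {f : MvPolynomial (Fin n) K}
    (hδ1 : 1 ≤ f.totalDegree) (w p : Fin n → K)
    (hp : MvPolynomial.eval p (Polynomial.resultant
      (MvPolynomial.aeval
        (fun i ↦ Polynomial.C (MvPolynomial.X i) + Polynomial.C (MvPolynomial.C (w i)) * Polynomial.X :
          Fin n → Polynomial (MvPolynomial (Fin n) K)) f)
      (Polynomial.derivative (MvPolynomial.aeval
        (fun i ↦ Polynomial.C (MvPolynomial.X i) + Polynomial.C (MvPolynomial.C (w i)) * Polynomial.X :
          Fin n → Polynomial (MvPolynomial (Fin n) K)) f))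
      f.totalDegree (f.totalDegree - 1)) ≠ 0) :
    IsCoprime
      (MvPolynomial.aeval
        (fun i ↦ Polynomial.C (p i) + Polynomial.C (w i) * Polynomial.X : Fin n → K[X]) f)
      (Polynomial.derivative (MvPolynomial.aeval
        (fun i ↦ Polynomial.C (p i) + Polynomial.C (w i) * Polynomial.X : Fin n → K[X]) f)) := by
  set δ := f.totalDegree with hδ
  set G := MvPolynomial.aeval
    (fun i ↦ Polynomial.C (MvPolynomial.X i) + Polynomial.C (MvPolynomial.C (w i)) * Polynomial.X :
      Fin n → Polynomial (MvPolynomial (Fin n) K)) f with hG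
  set P := Polynomial.resultant G (Polynomial.derivative G) δ (δ - 1) with hP
  set g := MvPolynomial.aeval
    (fun i ↦ Polynomial.C (p i) + Polynomial.C (w i) * Polynomial.X : Fin n → K[X]) f with hg
  have hmapG : G.map (MvPolynomial.eval p) = g := map_eval_lineRestrict f p w
  have hmapG' : (Polynomial.derivative G).map (MvPolynomial.eval p) = Polynomial.derivative g := by
    rw [← Polynomial.derivative_map, hmapG]
  have hres : Polynomial.resultant g (Polynomial.derivative g) δ (δ - 1) =
      MvPolynomial.eval p P := by
    rw [← hmapG', ← hmapG, Polynomial.resultant_map_map]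
  have hgdeg : g.natDegree ≤ δ := natDegree_map_eval_lineRestrict_le f p w
  have hg'deg : (Polynomial.derivative g).natDegree ≤ δ - 1 :=
    (Polynomial.natDegree_derivative_le g).trans (Nat.sub_le_sub_right hgdeg 1)
  obtain ⟨a, b, -, -, hab⟩ := Polynomial.exists_mul_add_mul_eq_C_resultant g
    (Polynomial.derivative g) hgdeg hg'deg (Or.inl (by omega))
  rw [hres] at hab
  set r := MvPolynomial.eval p P with hr
  refine ⟨Polynomial.C r⁻¹ * a, Polynomial.C r⁻¹ * b, ?_⟩
  calc Polynomial.C r⁻¹ * a * g + Polynomial.C r⁻¹ * b * Polynomial.derivative g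
      = Polynomial.C r⁻¹ * (g * a + Polynomial.derivative g * b) := by ring
    _ = 1 := by rw [hab, ← Polynomial.C_mul, inv_mul_cancel₀ hp, Polynomial.C_1]

/-! ### The bad `X`-directions for a good pair `(p, w)`: Kaltofen's certificate -/

/-- **For a good pair `(p, w)`, at most `δ²(2δ²-δ) q^{n-1}` directions `v` give a section
`f(p + Xv + Yw)` that is not absolutely irreducible** (Kaltofen's certificate `Υ` of the generic
plane section through the line `p + Tw`, specialised at the `K`-rational `v`; the argument of
`CafureMatera2006_thm54_holds`, Steps 2–4, counted). [cite: Kaltofen1995, Thm. 5]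
[cite: CafureMatera2006, Cor. 3.2] -/
theorem card_filter_not_irreducible_planeSection_le_of_good {f : MvPolynomial (Fin n) K}
    (hf : IsAbsIrreducible f) {w : Fin n → K}
    (hv : MvPolynomial.eval w (MvPolynomial.homogeneousComponent f.totalDegree f) ≠ 0)
    {p : Fin n → K}
    (hcop : IsCoprime
      (MvPolynomial.aeval
        (fun i ↦ Polynomial.C (p i) + Polynomial.C (w i) * Polynomial.X : Fin n → K[X]) f)
      (Polynomial.derivative (MvPolynomial.aeval
        (fun i ↦ Polynomial.C (p i) + Polynomial.C (w i) * Polynomial.X : Fin n → K[X]) f))) :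
    (Finset.univ.filter fun v : Fin n → K ↦
        ¬ Irreducible ((sec[f, p, v, w]).map
          (mapRingHom (algebraMap K (AlgebraicClosure K))))).card ≤
      f.totalDegree ^ 2 * (2 * f.totalDegree ^ 2 - f.totalDegree) * Fintype.card K ^ (n - 1) := by
  set Kbar := AlgebraicClosure K with hKbar
  set σ : K →+* Kbar := algebraMap K Kbar with hσ
  have hf' : Irreducible (MvPolynomial.map σ f) := hf
  set δ := f.totalDegree with hδ
  have hirrK : Irreducible f := irreducible_of_irreducible_mvPolynomial_map σ hf'
  have hδ1 : 1 ≤ δ := hf.totalDegree_pos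
  -- the univariate restriction `g = f(p + Tw)` and a simple root `α ∈ K̄`
  set g : K[X] := MvPolynomial.aeval
    (fun i ↦ Polynomial.C (p i) + Polynomial.C (w i) * Polynomial.X : Fin n → K[X]) f with hg
  have hgcoeff : g.coeff δ =
      MvPolynomial.eval w (MvPolynomial.homogeneousComponent δ f) :=
    coeff_map_eval_lineRestrict_totalDegree f p w
  have hgdegle : g.natDegree ≤ δ := natDegree_map_eval_lineRestrict_le f p w
  have hgdeg : g.natDegree = δ :=
    le_antisymm hgdegle (le_natDegree_of_ne_zero (by rw [hgcoeff]; exact hv))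
  have hg0 : g ≠ 0 := fun h ↦ by rw [h, natDegree_zero] at hgdeg; omega
  obtain ⟨α, hα, hα'⟩ := exists_root_derivative_ne_zero σ hcop (by rw [hgdeg]; omega)
  -- the generic plane section `χ` over `K̄` and its shape
  set μ' : Fin n → Kbar := σ ∘ p with hμ'
  set v' : Fin n → Kbar := σ ∘ w with hv'
  have hFdeg : (MvPolynomial.map σ f).totalDegree = δ := totalDegree_map_of_injective f σ.injective
  have hgbar : MvPolynomial.aeval (fun i ↦ C (μ' i) + C (v' i) * X : Fin n → Kbar[X])
      (MvPolynomial.map σ f) = g.map σ := aeval_affine_map_eq σ f p w hμ' hv'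
  have hgbar0 : MvPolynomial.aeval (fun i ↦ C (μ' i) + C (v' i) * X : Fin n → Kbar[X])
      (MvPolynomial.map σ f) ≠ 0 := by
    rw [hgbar]
    exact (Polynomial.map_ne_zero_iff σ.injective).2 hg0
  have hirrχ := irreducible_planeSubst hf' μ' v' hgbar0
  have hdegle := natDegree_planeSubst_le (MvPolynomial.map σ f) μ' v'
  have hcoeff := coeff_planeSubst_totalDegree (MvPolynomial.map σ f) μ' v'
  have htd := coeff_coeff_planeSubst_eq_zero (MvPolynomial.map σ f) μ' v'
  have hfil := filtration_planeSubst (MvPolynomial.map σ f) μ' v'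
  have hred := map_evalRingHom_zero_planeSubst (MvPolynomial.map σ f) μ' v'
  rw [hFdeg] at hdegle hcoeff htd
  rw [hgbar] at hred
  set c := MvPolynomial.eval w (MvPolynomial.homogeneousComponent δ f) with hc
  have hcbar : MvPolynomial.eval v' (MvPolynomial.homogeneousComponent δ (MvPolynomial.map σ f)) =
      σ c := by
    rw [homogeneousComponent_map, MvPolynomial.eval_map, hv', hc]
    show MvPolynomial.eval₂ σ (σ ∘ w) _ = σ (MvPolynomial.eval₂ (RingHom.id K) w _)
    rw [MvPolynomial.eval₂_comp_left σ (RingHom.id K) w, RingHom.comp_id]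
  have hσc : σ c ≠ 0 := (map_ne_zero σ).2 hv
  rw [hcbar] at hcoeff
  have hdegχ := le_antisymm hdegle (le_natDegree_of_ne_zero (by
    rw [hcoeff]
    exact Polynomial.C_ne_zero.2 (MvPolynomial.C_ne_zero.2 hσc)))
  have hleadχ := hcoeff
  rw [← hdegχ, coeff_natDegree] at hleadχ
  -- Kaltofen's certificate
  obtain ⟨Υ, hΥ0, hΥdeg, hΥirr⟩ :=
    exists_irreducibility_certificate hδ1 hdegχ hσc hleadχ hirrχ htd hfil hred hα hα'
  -- the bad `v` are roots of `Υ(σ v)`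
  calc (Finset.univ.filter fun v : Fin n → K ↦
          ¬ Irreducible ((sec[f, p, v, w]).map (mapRingHom σ))).card
      ≤ (Finset.univ.filter fun v : Fin n → K ↦ MvPolynomial.eval (σ ∘ v) Υ = 0).card := by
        refine Finset.card_le_card fun v hvmem ↦ ?_
        rw [Finset.mem_filter] at hvmem ⊢
        refine ⟨Finset.mem_univ _, ?_⟩
        by_contra hne
        have hI := hΥirr (σ ∘ v) hne
        rw [map_planeSubst_eval_eq σ f p w v hμ' hv'] at hI
        exact hvmem.2 hI
    _ ≤ Υ.totalDegree * Fintype.card K ^ (n - 1) := card_filter_eval_comp_eq_zero_le_of_ne_zero σ hΥ0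
    _ ≤ δ ^ 2 * (2 * δ ^ 2 - δ) * Fintype.card K ^ (n - 1) := Nat.mul_le_mul_right _ hΥdeg

/-! ### The count -/

/-- **Cafure–Matera Cor. 3.2, parametrised: few plane sections fail to be absolutely
irreducible.** For `f ∈ 𝔽_q[X₁, …, Xₙ]` absolutely irreducible of degree `δ`, the number of
`(p, v, w) ∈ (𝔽_qⁿ)³` whose section `f(p + Xv + Yw)` is not irreducible over `𝔽̄_q` is at most
`(δ + 1) q^{n-1} q^{2n} + (2δ-1)δ q^{n-1} q^{2n} + δ²(2δ²-δ) q^{n-1} q^{2n} ≤ (2δ⁴ - δ³ + 2δ² + 1) q^{3n-1}`: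
sort by the direction `w` (bad ones: `card_filter_badDirection_le`), then by the base point `p`
(bad ones for good `w`: roots of `Res_T(G, ∂G/∂T)`, at most `(2δ-1)δ q^{n-1}`), then count the bad
`v` for good `(p, w)` (`card_filter_not_irreducible_planeSection_le_of_good`).
[cite: CafureMatera2006, Cor. 3.2] [cite: Kaltofen1995, Thm. 5] -/
theorem card_filter_not_irreducible_planeSection_le {f : MvPolynomial (Fin n) K}
    (hf : IsAbsIrreducible f) :
    (Finset.univ.filter fun φ : (Fin n → K) × (Fin n → K) × (Fin n → K) ↦
        ¬ Irreducible ((sec[f, φ.1, φ.2.1, φ.2.2]).map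
          (mapRingHom (algebraMap K (AlgebraicClosure K))))).card ≤
      ((f.totalDegree + 1) + (f.totalDegree + (f.totalDegree - 1)) * f.totalDegree +
          f.totalDegree ^ 2 * (2 * f.totalDegree ^ 2 - f.totalDegree)) *
        Fintype.card K ^ (n - 1) * (Fintype.card K ^ n * Fintype.card K ^ n) := by
  set Kbar := AlgebraicClosure K with hKbar
  set σ : K →+* Kbar := algebraMap K Kbar with hσ
  have hf' : Irreducible (MvPolynomial.map σ f) := hf
  set δ := f.totalDegree with hδ
  set q := Fintype.card K with hq
  have hirrK : Irreducible f := irreducible_of_irreducible_mvPolynomial_map σ hf'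
  have hδ1 : 1 ≤ δ := hf.totalDegree_pos
  have hf0 : f ≠ 0 := hf.ne_zero
  -- some partial derivative is non-zero
  obtain ⟨i₀, hi₀⟩ := exists_pderiv_ne_zero hf'
  rw [MvPolynomial.pderiv_map] at hi₀
  have hi₀' : MvPolynomial.pderiv i₀ f ≠ 0 := fun h ↦ hi₀ (by rw [h, map_zero])
  -- the three classes
  set badW : Finset (Fin n → K) := Finset.univ.filter fun w ↦
    MvPolynomial.eval w (MvPolynomial.homogeneousComponent δ f) = 0 ∨
      (∑ i, MvPolynomial.C (w i) * MvPolynomial.pderiv i f) = 0 with hbadW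
  set res : (Fin n → K) → MvPolynomial (Fin n) K := fun w ↦ Polynomial.resultant
      (MvPolynomial.aeval
        (fun i ↦ Polynomial.C (MvPolynomial.X i) + Polynomial.C (MvPolynomial.C (w i)) * Polynomial.X :
          Fin n → Polynomial (MvPolynomial (Fin n) K)) f)
      (Polynomial.derivative (MvPolynomial.aeval
        (fun i ↦ Polynomial.C (MvPolynomial.X i) + Polynomial.C (MvPolynomial.C (w i)) * Polynomial.X :
          Fin n → Polynomial (MvPolynomial (Fin n) K)) f))
      δ (δ - 1) with hres
  set A := Finset.univ.filter fun φ : (Fin n → K) × (Fin n → K) × (Fin n → K) ↦ φ.2.2 ∈ badW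
    with hA
  set B := Finset.univ.filter fun φ : (Fin n → K) × (Fin n → K) × (Fin n → K) ↦
    φ.2.2 ∉ badW ∧ MvPolynomial.eval φ.1 (res φ.2.2) = 0 with hB
  set Cc := Finset.univ.filter fun φ : (Fin n → K) × (Fin n → K) × (Fin n → K) ↦
    φ.2.2 ∉ badW ∧ MvPolynomial.eval φ.1 (res φ.2.2) ≠ 0 ∧
      ¬ Irreducible ((sec[f, φ.1, φ.2.1, φ.2.2]).map (mapRingHom σ)) with hCc
  have hsub : (Finset.univ.filter fun φ : (Fin n → K) × (Fin n → K) × (Fin n → K) ↦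
      ¬ Irreducible ((sec[f, φ.1, φ.2.1, φ.2.2]).map (mapRingHom σ))) ⊆ A ∪ B ∪ Cc := by
    intro φ hφ
    have hφ' := (Finset.mem_filter.1 hφ).2
    by_cases hw : φ.2.2 ∈ badW
    · exact Finset.mem_union.2 (Or.inl (Finset.mem_union.2 (Or.inl
        (Finset.mem_filter.2 ⟨Finset.mem_univ _, hw⟩))))
    · by_cases hp : MvPolynomial.eval φ.1 (res φ.2.2) = 0
      · exact Finset.mem_union.2 (Or.inl (Finset.mem_union.2 (Or.inr
          (Finset.mem_filter.2 ⟨Finset.mem_univ _, hw, hp⟩))))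
      · exact Finset.mem_union.2 (Or.inr (Finset.mem_filter.2 ⟨Finset.mem_univ _, hw, hp, hφ'⟩))
  -- (i) the bad directions
  have hAcard : A.card ≤ (δ + 1) * q ^ (n - 1) * (q ^ n * q ^ n) := by
    have hbadW : badW.card ≤ (δ + 1) * q ^ (n - 1) := card_filter_badDirection_le hf0 hi₀'
    have : A = (Finset.univ : Finset (Fin n → K)) ×ˢ ((Finset.univ : Finset (Fin n → K)) ×ˢ badW) := by
      ext φ
      simp [hA]
    rw [this, Finset.card_product, Finset.card_product, Finset.card_univ, Fintype.card_fun,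
      Fintype.card_fin, ← hq]
    calc q ^ n * (q ^ n * badW.card) = badW.card * (q ^ n * q ^ n) := by ring
      _ ≤ (δ + 1) * q ^ (n - 1) * (q ^ n * q ^ n) := Nat.mul_le_mul_right _ hbadW
  -- (ii) the bad base points
  have hBcard : B.card ≤ (δ + (δ - 1)) * δ * q ^ (n - 1) * (q ^ n * q ^ n) := by
    -- fibre over `(v, w)`
    have hfib : ∀ w : Fin n → K, w ∉ badW →
        (Finset.univ.filter fun p : Fin n → K ↦ MvPolynomial.eval p (res w) = 0).card ≤
          (δ + (δ - 1)) * δ * q ^ (n - 1) := by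
      intro w hw
      rw [hbadW, Finset.mem_filter, not_and, not_or] at hw
      obtain ⟨hv, hD⟩ := hw (Finset.mem_univ w)
      have hres0 : res w ≠ 0 := resultant_lineRestrict_derivative_ne_zero hirrK hv hD
      have hresdeg : (res w).totalDegree ≤ (δ + (δ - 1)) * δ :=
        totalDegree_resultant_lineRestrict_le f w
      exact (rationalPointCount_le_totalDegree_mul hres0).trans (Nat.mul_le_mul_right _ hresdeg)
    rw [Finset.card_eq_sum_card_fiberwise (f := fun φ : (Fin n → K) × (Fin n → K) × (Fin n → K) ↦ φ.2)
      (t := Finset.univ) fun _ _ ↦ Finset.mem_univ _]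
    calc ∑ vw : (Fin n → K) × (Fin n → K), (B.filter fun φ ↦ φ.2 = vw).card
        ≤ ∑ _vw : (Fin n → K) × (Fin n → K), (δ + (δ - 1)) * δ * q ^ (n - 1) := by
          refine Finset.sum_le_sum fun vw _ ↦ ?_
          rcases vw with ⟨v, w⟩
          by_cases hw : w ∈ badW
          · rw [Finset.filter_false_of_mem, Finset.card_empty]
            · exact Nat.zero_le _
            · intro φ hφ heq
              rw [hB, Finset.mem_filter] at hφ
              rw [heq] at hφ
              exact hφ.2.1 hw
          · refine le_trans ?_ (hfib w hw)
            refine Finset.card_le_card_of_injOn (fun φ ↦ φ.1) (fun φ hφ ↦ ?_) (fun φ₁ h₁ φ₂ h₂ h ↦ ?_)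
            · rw [Finset.mem_coe, Finset.mem_filter, hB, Finset.mem_filter] at hφ
              obtain ⟨⟨-, -, hp⟩, heq⟩ := hφ
              rw [heq] at hp
              rw [Finset.mem_coe, Finset.mem_filter]
              exact ⟨Finset.mem_univ _, hp⟩
            · rw [Finset.mem_coe, Finset.mem_filter] at h₁ h₂
              exact Prod.ext h (h₁.2.trans h₂.2.symm)
      _ = (δ + (δ - 1)) * δ * q ^ (n - 1) * (q ^ n * q ^ n) := by
          rw [Finset.sum_const, Finset.card_univ, Fintype.card_prod, Fintype.card_fun,
            Fintype.card_fin, smul_eq_mul, ← hq]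
          ring
  -- (iii) the bad `v` for good `(p, w)`
  have hCcard : Cc.card ≤ δ ^ 2 * (2 * δ ^ 2 - δ) * q ^ (n - 1) * (q ^ n * q ^ n) := by
    have hfib : ∀ pw : (Fin n → K) × (Fin n → K), pw.2 ∉ badW →
        MvPolynomial.eval pw.1 (res pw.2) ≠ 0 →
        (Finset.univ.filter fun v : Fin n → K ↦
          ¬ Irreducible ((sec[f, pw.1, v, pw.2]).map (mapRingHom σ))).card ≤
          δ ^ 2 * (2 * δ ^ 2 - δ) * q ^ (n - 1) := by
      intro pw hw hp
      rw [hbadW, Finset.mem_filter, not_and, not_or] at hw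
      obtain ⟨hv, -⟩ := hw (Finset.mem_univ _)
      exact card_filter_not_irreducible_planeSection_le_of_good hf hv
        (isCoprime_lineSpecialization_of_eval_ne_zero hδ1 pw.2 pw.1 hp)
    rw [Finset.card_eq_sum_card_fiberwise
      (f := fun φ : (Fin n → K) × (Fin n → K) × (Fin n → K) ↦ (φ.1, φ.2.2))
      (t := Finset.univ) fun _ _ ↦ Finset.mem_univ _]
    calc ∑ pw : (Fin n → K) × (Fin n → K), (Cc.filter fun φ ↦ (φ.1, φ.2.2) = pw).card
        ≤ ∑ _pw : (Fin n → K) × (Fin n → K), δ ^ 2 * (2 * δ ^ 2 - δ) * q ^ (n - 1) := by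
          refine Finset.sum_le_sum fun pw _ ↦ ?_
          rcases pw with ⟨p, w⟩
          by_cases hw : w ∈ badW
          · rw [Finset.filter_false_of_mem, Finset.card_empty]
            · exact Nat.zero_le _
            · intro φ hφ heq
              rw [hCc, Finset.mem_filter] at hφ
              rw [Prod.mk.injEq] at heq
              rw [heq.2] at hφ
              exact hφ.2.1 hw
          by_cases hp : MvPolynomial.eval p (res w) = 0
          · rw [Finset.filter_false_of_mem, Finset.card_empty]
            · exact Nat.zero_le _
            · intro φ hφ heq
              rw [hCc, Finset.mem_filter] at hφ
              rw [Prod.mk.injEq] at heq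
              rw [heq.1, heq.2] at hφ
              exact hφ.2.2.1 hp
          · refine le_trans ?_ (hfib (p, w) hw hp)
            refine Finset.card_le_card_of_injOn (fun φ ↦ φ.2.1) (fun φ hφ ↦ ?_)
              (fun φ₁ h₁ φ₂ h₂ h ↦ ?_)
            · rw [Finset.mem_coe, Finset.mem_filter, hCc, Finset.mem_filter] at hφ
              obtain ⟨⟨-, -, -, hirr⟩, heq⟩ := hφ
              rw [Prod.mk.injEq] at heq
              rw [heq.1, heq.2] at hirr
              rw [Finset.mem_coe, Finset.mem_filter]
              exact ⟨Finset.mem_univ _, hirr⟩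
            · rw [Finset.mem_coe, Finset.mem_filter, Prod.mk.injEq] at h₁ h₂
              exact Prod.ext (h₁.2.1.trans h₂.2.1.symm)
                (Prod.ext h (h₁.2.2.trans h₂.2.2.symm))
      _ = δ ^ 2 * (2 * δ ^ 2 - δ) * q ^ (n - 1) * (q ^ n * q ^ n) := by
          rw [Finset.sum_const, Finset.card_univ, Fintype.card_prod, Fintype.card_fun,
            Fintype.card_fin, smul_eq_mul, ← hq]
          ring
  calc _ ≤ (A ∪ B ∪ Cc).card := Finset.card_le_card hsub
    _ ≤ A.card + B.card + Cc.card :=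
        (Finset.card_union_le _ _).trans (Nat.add_le_add_right (Finset.card_union_le _ _) _)
    _ ≤ (δ + 1) * q ^ (n - 1) * (q ^ n * q ^ n) + (δ + (δ - 1)) * δ * q ^ (n - 1) * (q ^ n * q ^ n) +
          δ ^ 2 * (2 * δ ^ 2 - δ) * q ^ (n - 1) * (q ^ n * q ^ n) :=
        Nat.add_le_add (Nat.add_le_add hAcard hBcard) hCcard
    _ = _ := by ring

end Literature.NumberTheory.DiophantineGeometry
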